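import Literature.Probability.RandomPlanarGeometry.SAWTriangularEndpointSurgery
import HarnessLib

/-!
# The transfer counts (P1), (P2) for walks of `𝕋` with a fixed endpoint

Topic `Literature/Probability/RandomPlanarGeometry` (lane «pcv-sawmu», item «TRI-ENDPOINT»; continues
`SAWTriangularEndpointSurgery.lean`). Source: N. Madras, G. Slade, *The Self-Avoiding Walk* (1993), §7.3, proof of
Theorem 7.3.2, (7.3.6)–(7.3.7), and Theorem 7.3.2(c)/7.3.4(b) (fixed endpoint). These are the tree's `triKesten_P1'`/`triKesten_P1`
(`SAWTriangularKestenTransfer.lean`) and `sum_card_triSlots_div_le_triSawCount`/`triKesten_P2` (`SAWTriangularDoubleTransfer.lean`)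
VERBATIM over the fixed-endpoint family `triSLx N x` (all slots and all sharp turns are admissible: the surgery is interior),
with the all-walk bookkeeping constants (`1 ≤ J' ≤ J + 3`, `J ≤ J' + 2`, `I ≤ I' + 8`) of `SAWTriangularDetourSurgery.lean`.

## Contents (namespace `Literature.Probability.RandomPlanarGeometry.SAW`)

* `triEndpointKesten_P1'`, `triEndpointKesten_P1` — `#{ω' ∈ S_{N+1}(x) : J ≥ 1} ≤ Σ_{ω ∈ S_N(x)} I(ω)/max(J(ω) − 2, 1)`;
* `sum_card_triSlots_div_le_card_triSLx` — `Σ_{ω' ∈ S_{N+1}(x)} I(ω')/(J(ω')+3) ≤ #S_{N+2}(x)`;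
* `triEndpointKesten_P2` — `Σ_{ω ∈ S_N(x)} I (I − 8)^+ /((J+3)(J+6)) ≤ #S_{N+2}(x)`.
-/

noncomputable section

open Finset
open Literature.Probability.LatticeModels Literature.Probability.Percolation SimpleGraph

namespace Literature.Probability.RandomPlanarGeometry.SAW

/-! ### (P1) for the fixed-endpoint family -/

section TransferP1

/-- **(P1) for the fixed-endpoint family, the first counting** (Madras–Slade (7.3.6) with inexact bookkeeping; shape of `hP1`,
`c₁ = 2`): the number of `(N+1)`-step FIXED-ENDPOINT WALKS of `𝕋` with at least one sharp turn equals `Σ_{(ω,s)} 1/J(ins_s ω)`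
over the slot pairs of `S_N(x)`, and `J(ins_s ω) ≥ max(J(ω) − 2, 1)`.
[cite: MadrasSlade1993, Theorem 7.3.2 (proof), (7.3.6), and Theorem 7.3.4(b)] -/
theorem triEndpointKesten_P1' (N : ℕ) (x : Site 2) :
    (#((triSLx (N + 1) x).filter fun ω' => 1 ≤ #(triSharp ω')) : ℝ) ≤
      ∑ ω ∈ triSLx N x, (#(triSlots ω) : ℝ) / max ((#(triSharp ω) : ℝ) - 2) 1 := by
  -- the left side is `Σ_{ω'} J(ω') · (1/J(ω'))`, a sum over the sharp-turn pairs of `S_{N+1}`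
  have hJ : (#((triSLx (N + 1) x).filter fun ω' => 1 ≤ #(triSharp ω')) : ℝ) =
      ∑ ω ∈ triSLx (N + 1) x, (#(triSharp ω) : ℝ) * (1 / (#(triSharp ω) : ℝ)) := by
    rw [card_eq_sum_ones, Nat.cast_sum, sum_filter]
    refine sum_congr rfl fun ω _ => ?_
    by_cases h : 1 ≤ #(triSharp ω)
    · rw [if_pos h, Nat.cast_one, mul_one_div_cancel]
      exact_mod_cast (show #(triSharp ω) ≠ 0 by omega)
    · rw [if_neg h, show #(triSharp ω) = 0 by omega]
      simp
  rw [hJ, ← sum_triSharpPairsX (N + 1) x (fun ω => 1 / (#(triSharp ω) : ℝ)),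
    ← sum_triSlotPairsX_eq_sum_triSharpPairsX N x (fun p => 1 / (#(triSharp (triIns p.2.1 p.2.2 p.1)) : ℝ))
      (fun q => 1 / (#(triSharp q.1) : ℝ)) (fun p _ => rfl)]
  -- termwise `1/J(ins) ≤ 1/max(J − 2, 1)`, then re-sum over walks
  have hR : ∑ ω ∈ triSLx N x, (#(triSlots ω) : ℝ) / max ((#(triSharp ω) : ℝ) - 2) 1 =
      ∑ p ∈ triSlotPairsX N x, 1 / max ((#(triSharp p.1) : ℝ) - 2) 1 := by
    rw [sum_triSlotPairsX N x (fun ω => 1 / max ((#(triSharp ω) : ℝ) - 2) 1)]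
    refine sum_congr rfl fun ω _ => ?_
    rw [mul_one_div]
  rw [hR]
  refine sum_le_sum fun p hp => ?_
  obtain ⟨ω, m, z⟩ := p
  rw [triSlotPairsX, mem_sigma] at hp
  dsimp only at hp ⊢
  obtain ⟨hω, hs⟩ := hp
  obtain ⟨hm, -, -, -⟩ := mem_triSlots.1 hs
  have h1 : (1 : ℝ) ≤ #(triSharp (triIns m z ω)) := by exact_mod_cast one_le_card_triSharp_triIns (triSL_of_mem_triSLx hω) hs
  have h2 : (#(triSharp ω) : ℝ) - 2 ≤ #(triSharp (triIns m z ω)) := by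
    have := card_triSharp_le_triIns (z := z) (ω := ω) (le_of_lt hm)
    have h' : (#(triSharp ω) : ℝ) ≤ #(triSharp (triIns m z ω)) + 2 := by exact_mod_cast this
    linarith
  exact one_div_le_one_div_of_le (lt_of_lt_of_le one_pos (le_max_right _ _)) (max_le h2 h1)

/-- **(P1) for the fixed-endpoint family**, partition form: `#S_{N+1}(x) − #{ω' ∈ S_{N+1}(x) : J(ω') = 0} ≤
Σ_{ω ∈ S_N(x)} I(ω)/max(1, J(ω) − 2)`. [cite: MadrasSlade1993, Theorem 7.3.2 (proof), (7.3.6), and Theorem 7.3.4(b)] -/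
theorem triEndpointKesten_P1 (N : ℕ) (x : Site 2) :
    (#(triSLx (N + 1) x) : ℝ) - #((triSLx (N + 1) x).filter fun ω => #(triSharp ω) = 0) ≤
      ∑ ω ∈ triSLx N x, (#(triSlots ω) : ℝ) / max 1 ((#(triSharp ω) : ℝ) - 2) := by
  have hsplit := card_filter_add_card_filter_not (s := triSLx (N + 1) x) (p := fun ω => #(triSharp ω) = 0)
  have hL : (#(triSLx (N + 1) x) : ℝ) - #((triSLx (N + 1) x).filter fun ω => #(triSharp ω) = 0) =
      #((triSLx (N + 1) x).filter fun ω' => 1 ≤ #(triSharp ω')) := by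
    have h : (#(triSLx (N + 1) x) : ℝ) = #((triSLx (N + 1) x).filter fun ω => #(triSharp ω) = 0) +
        #((triSLx (N + 1) x).filter fun ω => ¬#(triSharp ω) = 0) := by
      exact_mod_cast hsplit.symm
    have e : ((triSLx (N + 1) x).filter fun ω => ¬#(triSharp ω) = 0) =
        ((triSLx (N + 1) x).filter fun ω' => 1 ≤ #(triSharp ω')) :=
      filter_congr fun ω _ => by omega
    rw [← e]
    linarith
  rw [hL]
  simp only [max_comm (1 : ℝ)]
  exact triEndpointKesten_P1' N x

end TransferP1

/-! ### (P2) for the fixed-endpoint family -/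

section DoubleTransfer

/-- **Level `N+1` for the fixed-endpoint family (single step of (7.3.7))**: `Σ_{ω' ∈ S_{N+1}(x)} I(ω')/(J(ω')+3) ≤ #S_{N+2}(x)` — each
slot pair `(ω', s)` is sent to the sharp-turn pair `(triIns s ω', ·)`, a walk `ω''` of `S_{N+2}(x)` receiving exactly
`J(ω'')` of them, and `J(triIns s ω') ≤ J(ω') + 3`. [cite: MadrasSlade1993, Theorem 7.3.2 (proof), eq. (7.3.7), and Theorem 7.3.4(b)] -/
theorem sum_card_triSlots_div_le_card_triSLx (N : ℕ) (x : Site 2) :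
    ∑ ω ∈ triSLx (N + 1) x, (#(triSlots ω) : ℝ) / ((#(triSharp ω) : ℝ) + 3) ≤ (#(triSLx (N + 2) x) : ℝ) := by
  classical
  have e1 : ∑ ω ∈ triSLx (N + 1) x, (#(triSlots ω) : ℝ) / ((#(triSharp ω) : ℝ) + 3) =
      ∑ p ∈ triSlotPairsX (N + 1) x, 1 / ((#(triSharp p.1) : ℝ) + 3) := by
    rw [sum_triSlotPairsX (N + 1) x (fun ω => 1 / ((#(triSharp ω) : ℝ) + 3))]
    exact sum_congr rfl fun ω _ => by rw [mul_one_div]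
  have e2 : ∑ p ∈ triSlotPairsX (N + 1) x, 1 / ((#(triSharp p.1) : ℝ) + 3) ≤
      ∑ p ∈ triSlotPairsX (N + 1) x, 1 / (#(triSharp (triIns p.2.1 p.2.2 p.1)) : ℝ) := by
    refine sum_le_sum fun p hp => ?_
    rw [triSlotPairsX, Finset.mem_sigma] at hp
    obtain ⟨hω, hs⟩ := hp
    have hs' : (p.2.1, p.2.2) ∈ triSlots p.1 := hs
    have hJ1 := one_le_card_triSharp_triIns (triSL_of_mem_triSLx hω) hs'
    obtain ⟨hm, -, -, -⟩ := mem_triSlots.1 hs'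
    have hJ3 := card_triSharp_triIns_le (z := p.2.2) (ω := p.1) (m := p.2.1) (by omega)
    have hpos : (0 : ℝ) < #(triSharp (triIns p.2.1 p.2.2 p.1)) := by exact_mod_cast hJ1
    apply one_div_le_one_div_of_le hpos
    exact_mod_cast hJ3
  have e3 : ∑ p ∈ triSlotPairsX (N + 1) x, 1 / (#(triSharp (triIns p.2.1 p.2.2 p.1)) : ℝ) =
      ∑ q ∈ triSharpPairsX (N + 1 + 1) x, 1 / (#(triSharp q.1) : ℝ) :=
    sum_triSlotPairsX_eq_sum_triSharpPairsX (N + 1) x _ (fun q => 1 / (#(triSharp q.1) : ℝ)) fun p _ => rfl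
  have e4 : ∑ q ∈ triSharpPairsX (N + 1 + 1) x, 1 / (#(triSharp q.1) : ℝ) ≤ (#(triSLx (N + 2) x) : ℝ) := by
    rw [sum_triSharpPairsX (N + 1 + 1) x (fun ω => 1 / (#(triSharp ω) : ℝ)), show N + 2 = N + 1 + 1 by ring,
      Finset.card_eq_sum_ones, Nat.cast_sum]
    refine sum_le_sum fun ω _ => ?_
    by_cases h : #(triSharp ω) = 0
    · rw [h]; simp
    · rw [mul_one_div_cancel (by exact_mod_cast h)]; simp
  rw [e1]
  exact e2.trans (e3.le.trans e4)

/-- **(P2) for the fixed-endpoint family, the double transfer (Madras–Slade (7.3.7), one-step detour variant on `𝕋`)**: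
`Σ_{ω ∈ S_N(x)} I(ω) · max(0, I(ω) − 8) / ((J(ω)+3)(J(ω)+6)) ≤ #S_{N+2}(x)`, `I = #triSlots`, `J = #triSharp` — two
admissible detour insertions, counted through the slot-pair/sharp-pair bijection twice, with the bookkeeping
`1 ≤ J' ≤ J + 3` and `I ≤ I' + 8` of `SAWTriangularDetourSurgery`.
[cite: MadrasSlade1993, Theorem 7.3.2 (proof), eq. (7.3.7) (p. 245), and Theorem 7.3.4(b)] -/
theorem triEndpointKesten_P2 (N : ℕ) (x : Site 2) :
    ∑ ω ∈ triSLx N x, (#(triSlots ω) : ℝ) * max 0 ((#(triSlots ω) : ℝ) - 8) /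
        (((#(triSharp ω) : ℝ) + 3) * ((#(triSharp ω) : ℝ) + 6)) ≤ (#(triSLx (N + 2) x) : ℝ) := by
  classical
  refine le_trans ?_ (sum_card_triSlots_div_le_card_triSLx N x)
  -- level `N`: the weight `g(ω') = I'/((J'+3) J')`, so that `J' · g(ω') = I'/(J'+3)` when `J' ≥ 1`
  set g : List (Site 2) → ℝ := fun ω' =>
    (#(triSlots ω') : ℝ) / (((#(triSharp ω') : ℝ) + 3) * (#(triSharp ω') : ℝ)) with hg
  have hB : ∑ ω' ∈ triSLx (N + 1) x, (#(triSharp ω') : ℝ) * g ω' ≤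
      ∑ ω' ∈ triSLx (N + 1) x, (#(triSlots ω') : ℝ) / ((#(triSharp ω') : ℝ) + 3) := by
    refine sum_le_sum fun ω' _ => ?_
    by_cases h : #(triSharp ω') = 0
    · rw [h]; simp only [Nat.cast_zero, zero_mul, zero_add]; positivity
    · have hpos : (0 : ℝ) < #(triSharp ω') := by exact_mod_cast Nat.pos_of_ne_zero h
      rw [hg]
      rw [show (#(triSharp ω') : ℝ) * ((#(triSlots ω') : ℝ) /
          (((#(triSharp ω') : ℝ) + 3) * (#(triSharp ω') : ℝ))) =
          (#(triSlots ω') : ℝ) / ((#(triSharp ω') : ℝ) + 3) by field_simp]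
  refine le_trans ?_ hB
  rw [← sum_triSharpPairsX (N + 1) x g]
  rw [← sum_triSlotPairsX_eq_sum_triSharpPairsX N x (fun p => g (triIns p.2.1 p.2.2 p.1)) (fun q => g q.1) fun p _ => rfl]
  rw [show ∑ ω ∈ triSLx N x, (#(triSlots ω) : ℝ) * max 0 ((#(triSlots ω) : ℝ) - 8) /
      (((#(triSharp ω) : ℝ) + 3) * ((#(triSharp ω) : ℝ) + 6)) =
      ∑ ω ∈ triSLx N x, (#(triSlots ω) : ℝ) * (max 0 ((#(triSlots ω) : ℝ) - 8) /
      (((#(triSharp ω) : ℝ) + 3) * ((#(triSharp ω) : ℝ) + 6))) from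
    sum_congr rfl fun ω _ => by rw [mul_div_assoc]]
  rw [← sum_triSlotPairsX N x (fun ω => max 0 ((#(triSlots ω) : ℝ) - 8) /
      (((#(triSharp ω) : ℝ) + 3) * ((#(triSharp ω) : ℝ) + 6)))]
  refine sum_le_sum fun p hp => ?_
  rw [triSlotPairsX, Finset.mem_sigma] at hp
  obtain ⟨hω, hs⟩ := hp
  have hs' : (p.2.1, p.2.2) ∈ triSlots p.1 := hs
  obtain ⟨hm, -, -, -⟩ := mem_triSlots.1 hs'
  set ω' := triIns p.2.1 p.2.2 p.1 with hω'
  have hJ1 : (1 : ℝ) ≤ #(triSharp ω') := by exact_mod_cast one_le_card_triSharp_triIns (triSL_of_mem_triSLx hω) hs'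
  have hJ3 : (#(triSharp ω') : ℝ) ≤ #(triSharp p.1) + 3 := by
    exact_mod_cast card_triSharp_triIns_le (z := p.2.2) (ω := p.1) (m := p.2.1) (by omega)
  have hI : (#(triSlots p.1) : ℝ) ≤ #(triSlots ω') + 8 := by
    exact_mod_cast card_triSlots_le_triIns (triSL_of_mem_triSLx hω) hs'
  have hJ0 : (0 : ℝ) ≤ #(triSharp p.1) := Nat.cast_nonneg _
  have hI0 : (0 : ℝ) ≤ #(triSlots ω') := Nat.cast_nonneg _
  show max 0 ((#(triSlots p.1) : ℝ) - 8) / (((#(triSharp p.1) : ℝ) + 3) * ((#(triSharp p.1) : ℝ) + 6)) ≤ g ω'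
  rw [hg]; simp only
  have hden : ((#(triSharp ω') : ℝ) + 3) * (#(triSharp ω') : ℝ) ≤
      ((#(triSharp p.1) : ℝ) + 3) * ((#(triSharp p.1) : ℝ) + 6) := by nlinarith
  have hden0 : 0 < ((#(triSharp ω') : ℝ) + 3) * (#(triSharp ω') : ℝ) := by positivity
  rcases le_or_gt ((#(triSlots p.1) : ℝ) - 8) 0 with hneg | hpos
  · rw [max_eq_left hneg, zero_div]
    exact div_nonneg hI0 hden0.le
  · rw [max_eq_right hpos.le]
    calc ((#(triSlots p.1) : ℝ) - 8) / (((#(triSharp p.1) : ℝ) + 3) * ((#(triSharp p.1) : ℝ) + 6))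
        ≤ ((#(triSlots p.1) : ℝ) - 8) / (((#(triSharp ω') : ℝ) + 3) * (#(triSharp ω') : ℝ)) :=
          div_le_div_of_nonneg_left hpos.le hden0 hden
      _ ≤ (#(triSlots ω') : ℝ) / (((#(triSharp ω') : ℝ) + 3) * (#(triSharp ω') : ℝ)) :=
          div_le_div_of_nonneg_right (by linarith) hden0.le

end DoubleTransfer

end Literature.Probability.RandomPlanarGeometry.SAW
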